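import Summits.Langlands.Langlands.Theses.DescentCoprimalityLadder

/-!
# Route DescentCoprimalityLadder — Assembly

The assembly item (stmt-Langlands-28286) of the child route `DescentCoprimalityLadder` (decomp-langlands lens-1 gen 25; V-R refining child
`--refines route-Langlands-ImageOrderLadder:LargeOrInsolubleArtinAutomorphy`, 88th cell route) for REST = `ImageOrderLadder.LargeOrInsolubleArtinAutomorphy` (stmt-Langlands-28018):
`TetrahedralMonomialArtinAutomorphy → OctahedralMonomialArtinAutomorphy → NonQuarticMonomialArtinAutomorphy → Summit.Langlands.Langlands.Theses.ImageOrderLadder.LargeOrInsolubleArtinAutomorphy`.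

This is literally the type of the route file's sorry-free deciding theorem `Summit.Langlands.Langlands.Theses.DescentCoprimalityLadder.closes`.
Nothing here proves `Langlands` (nor the parent piece): the assembly records only that the items of the route, taken together, imply the parent piece
by name.
-/

set_option linter.dupNamespace false -- project-wide option (lakefile weak.linter.dupNamespace); `Summit.Langlands.Langlands` is the mandated namespace

namespace Summit.Langlands.Langlands.Theorems

/-- **Assembly of route DescentCoprimalityLadder** (stmt-Langlands-28286):
`TetrahedralMonomialArtinAutomorphy → OctahedralMonomialArtinAutomorphy → NonQuarticMonomialArtinAutomorphy → Summit.Langlands.Langlands.Theses.ImageOrderLadder.LargeOrInsolubleArtinAutomorphy`.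
Proof: unfold `Assembly` and apply the route's deciding theorem `Theses.DescentCoprimalityLadder.closes`. -/
theorem descentCoprimalityLadder_assembly_proof :
    Summit.Langlands.Langlands.Theses.DescentCoprimalityLadder.Assembly := by
  unfold Summit.Langlands.Langlands.Theses.DescentCoprimalityLadder.Assembly
  exact Summit.Langlands.Langlands.Theses.DescentCoprimalityLadder.closes

end Summit.Langlands.Langlands.Theorems
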